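import Summits.Ventures.DiscreteObjects.Hadamard.GroupCore334
import Summits.Ventures.DiscreteObjects.Hadamard.ConferenceGraph333

/-!
# No `C(334)` with a group-developed core — the matrix, bordered and partial-difference-set forms (kernel)

Framing: lottery ticket; floor = certified bounds/negative ranges.  Cell pub-namedobj (venture DiscreteObjects),
target (H), hadamard gen 28; companion of `GroupCore334` (`no_groupCore_conference334`: no cored `±1` array `a` on a
group `G` of order `333` with `Σ_u a(u)a(ut) = −1`, `t ≠ 1`).  This file spells the same exclusion out in the forms in
which the object occurs in print, all for an ARBITRARY group `G` of order `333`: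
* **`no_groupCore_conference334_left`** — the left-translate convention `Σ_u a(u)a(tu) = −1` (apply the theorem to `Gᵐᵒᵖ`);
* **`no_groupMatrixCore_conference334`** — no group matrix `S_{g,h} = a(g⁻¹h)` (`a(1) = 0`, `a = ±1` elsewhere) has
  `(S Sᵀ)_{g,k} = −1` for all `g ≠ k` (a fortiori none has `S Sᵀ = 333·I − J`); `'`-version for `S_{g,h} = a(g h⁻¹)`;
* **`no_conference334_groupCore`** — no conference matrix `C` of order `334` (`0` diagonal, `±1` off it,
  `C Cᵀ = 333·I`), indexed by `Option G` with border point `none` and constant (e.g. normalised) border column, has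
  core `C_{g,h} = a(g⁻¹h)` developed over `G`; **`no_conference334_regularAction`** — equivalently no `C(334)` is
  invariant under a group of (unsigned) permutations fixing one point and acting regularly on the other `333`;
  **`no_cayley_srg333`** — no `srg(333,166,82,83)` (gen 27 `ConferenceGraph333` hypotheses) is a Cayley graph;
* **`pds_autocorr_left`** — for `D ⊆ G ∖ {1}` and the array `a = [· ∈ D] − [· ∉ D ∪ {1}]`:
  `Σ_u a(u)a(gu) = 4·#{d ∈ D : g d ∈ D} − 4|D| + |G| − 2 + 2([g ∈ D] + [g⁻¹ ∈ D])` (`g ≠ 1`, any finite group);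
* **`no_paleyTypePDS_333`** — NO regular partial difference set with the Paley parameters `(333, 166, 82, 83)`
  (`1 ∉ D = D⁻¹`, `|D| = 166`, `d₁d₂⁻¹` represents `g ≠ 1` exactly `82` / `83` times for `g ∈ D` / `g ∉ D`,
  Seberry–Yamada 2020 §1.9.3 / §8.4) in ANY group of order `333`; equivalently no strongly regular Cayley graph
  `srg(333,166,82,83)`.  Abelian case in print (Ma 1984/1994); nonabelian case ours, PROVISIONAL (see `GroupCore334`).
No `sorry`, no new definitions; `C(334)`, `srg(333,166,82,83)`, `H(668)` untouched.
-/

namespace Summit.Ventures.DiscreteObjects.Hadamard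

open Finset
open scoped Matrix

section forms
variable {G : Type*} [Group G] [Fintype G] [DecidableEq G]

/-- **Left-translate convention.** No cored `±1` array on a group of order `333` with `Σ_u a(u)a(tu) = −1` for all
`t ≠ 1` (the theorem `no_groupCore_conference334` applied to the opposite group `Gᵐᵒᵖ`). -/
theorem no_groupCore_conference334_left (hG : Fintype.card G = 333) (a : G → ℤ) (ha1 : a 1 = 0)
    (ha : ∀ g, g ≠ 1 → a g = 1 ∨ a g = -1) (hC : ∀ t, t ≠ 1 → ∑ u, a u * a (t * u) = -1) : False := by
  letI : Fintype Gᵐᵒᵖ := Fintype.ofEquiv G MulOpposite.opEquiv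
  refine no_groupCore_conference334 (G := Gᵐᵒᵖ) ?_ (fun u => a (MulOpposite.unop u)) (by simpa using ha1)
    (fun g hg => ha (MulOpposite.unop g) (by simpa using hg)) fun t ht => ?_
  · rw [← hG]; exact Fintype.card_congr MulOpposite.opEquiv.symm
  · rw [← hC (MulOpposite.unop t) (by simpa using ht)]
    exact Fintype.sum_equiv MulOpposite.opEquiv.symm _ _ fun u => by simp

/-- **Group-matrix form** (`S_{g,h} = a(g⁻¹h)`).  No group matrix over a group of order `333` developed from a cored
`±1` array has all off-diagonal entries of `S Sᵀ` equal to `−1`; in particular none satisfies `S Sᵀ = 333·I − J`,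
the core equation of a normalised conference matrix of order `334`. -/
theorem no_groupMatrixCore_conference334 (hG : Fintype.card G = 333) (a : G → ℤ) (ha1 : a 1 = 0)
    (ha : ∀ g, g ≠ 1 → a g = 1 ∨ a g = -1) (S : Matrix G G ℤ) (hS : ∀ g h, S g h = a (g⁻¹ * h))
    (hSS : ∀ g k, g ≠ k → (S * Sᵀ) g k = -1) : False := by
  refine no_groupCore_conference334_left hG a ha1 ha fun t ht => ?_
  have h := hSS t 1 ht
  simp only [Matrix.mul_apply, Matrix.transpose_apply, hS, inv_one, one_mul] at h
  rw [← h]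
  exact Fintype.sum_equiv (Equiv.mulLeft t) _ _ fun u => by simp

/-- The same for the other group-matrix convention `S_{g,h} = a(g h⁻¹)`. -/
theorem no_groupMatrixCore_conference334' (hG : Fintype.card G = 333) (a : G → ℤ) (ha1 : a 1 = 0)
    (ha : ∀ g, g ≠ 1 → a g = 1 ∨ a g = -1) (S : Matrix G G ℤ) (hS : ∀ g h, S g h = a (g * h⁻¹))
    (hSS : ∀ g k, g ≠ k → (S * Sᵀ) g k = -1) : False := by
  refine no_groupCore_conference334_left hG a ha1 ha fun t ht => ?_
  have h := hSS t 1 ht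
  simp only [Matrix.mul_apply, Matrix.transpose_apply, hS, one_mul] at h
  rw [← h]
  exact Fintype.sum_equiv (Equiv.inv G) _ _ fun u => by simp [mul_comm]

/-- **Bordered form.**  No conference matrix of order `334` — zero diagonal, `±1` off the diagonal, `C Cᵀ = 333·I` —
indexed by `Option G` for a group `G` of order `333`, with border point `none`, CONSTANT border column
(`C_{g,none} = C_{1,none}`, e.g. the normalised border `+1`) and core `C_{g,h} = a(g⁻¹h)` developed over `G`.
(`a(1) = C_{1,1} = 0` and `a = ±1` elsewhere follow from the conference hypotheses; rows `g ≠ k` of `C Cᵀ` give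
`c² + (S Sᵀ)_{g,k} = 0` with `c = ±1` the border entry.) -/
theorem no_conference334_groupCore (hG : Fintype.card G = 333) (C : Matrix (Option G) (Option G) ℤ)
    (hdiag : ∀ i, C i i = 0) (hoff : ∀ i j, i ≠ j → C i j = 1 ∨ C i j = -1)
    (hC : C * Cᵀ = (333 : ℤ) • (1 : Matrix (Option G) (Option G) ℤ))
    (hcol : ∀ g, C (some g) none = C (some 1) none) (a : G → ℤ) (hcore : ∀ g h, C (some g) (some h) = a (g⁻¹ * h)) :
    False := by
  have ha1 : a 1 = 0 := by have h := hdiag (some 1); rwa [hcore, inv_one, one_mul] at h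
  have ha : ∀ g, g ≠ 1 → a g = 1 ∨ a g = -1 := by
    intro g hg
    have := hoff (some 1) (some g) (by simpa using hg.symm)
    rwa [hcore, inv_one, one_mul] at this
  have hcc : C (some 1) none * C (some 1) none = 1 := by
    rcases hoff (some 1) none (by simp) with h | h <;> rw [h] <;> norm_num
  refine no_groupCore_conference334_left hG a ha1 ha fun t ht => ?_
  have h := congrFun (congrFun hC (some t)) (some 1)
  rw [Matrix.mul_apply, Fintype.sum_option] at h
  simp only [Matrix.transpose_apply, hcol t, hcc, hcore, inv_one, one_mul, Matrix.smul_apply,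
    Matrix.one_apply, Option.some.injEq, ht, if_false, smul_zero] at h
  -- h : 1 + Σ_h a (t⁻¹ h) a h = 0
  have h' : ∑ x, a (t⁻¹ * x) * a x = -1 := by linarith
  rw [← h']
  exact Fintype.sum_equiv (Equiv.mulLeft t) _ _ fun u => by simp

/-- **Regular-action form.**  No conference matrix of order `334` indexed by `Option G`, `|G| = 333`, is invariant under
the left-regular action of `G` on the `333` non-border points (`C_{x·i, x·j} = C_{i,j}`, `x` fixing `none`): i.e. no
`C(334)` has an automorphism group fixing a point and acting regularly on the other `333` (unsigned permutation
automorphisms; such a core is group-developed with `a(u) = C_{1,u}`). -/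
theorem no_conference334_regularAction (hG : Fintype.card G = 333) (C : Matrix (Option G) (Option G) ℤ)
    (hdiag : ∀ i, C i i = 0) (hoff : ∀ i j, i ≠ j → C i j = 1 ∨ C i j = -1)
    (hC : C * Cᵀ = (333 : ℤ) • (1 : Matrix (Option G) (Option G) ℤ))
    (hinv : ∀ (x : G) (i j : Option G), C (i.map (x * ·)) (j.map (x * ·)) = C i j) : False := by
  refine no_conference334_groupCore hG C hdiag hoff hC (fun g => ?_) (fun u => C (some 1) (some u)) fun g h => ?_
  · have := hinv g⁻¹ (some g) none
    simpa using this.symm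
  · have := hinv g⁻¹ (some g) (some h)
    simpa using this.symm

/-- **PDS ⇒ autocorrelation.**  For a subset `D` of a finite group not containing `1` and `g ≠ 1`, the cored array
`a(u) = 0 (u = 1), +1 (u ∈ D), −1 (otherwise)` has
`Σ_u a(u)a(gu) = 4·#{d ∈ D : g d ∈ D} − 4|D| + |G| − 2 + 2([g ∈ D] + [g⁻¹ ∈ D])`. -/
theorem pds_autocorr_left (D : Finset G) (h1 : (1 : G) ∉ D) {g : G} (hg : g ≠ 1) :
    ∑ u, (if u = 1 then (0 : ℤ) else if u ∈ D then 1 else -1) *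
        (if g * u = 1 then (0 : ℤ) else if g * u ∈ D then 1 else -1) =
      4 * ((univ.filter fun d => d ∈ D ∧ g * d ∈ D).card : ℤ) - 4 * D.card + Fintype.card G - 2 +
        2 * ((if g ∈ D then 1 else 0) + (if g⁻¹ ∈ D then 1 else 0)) := by
  set ind : G → ℤ := fun u => if u ∈ D then 1 else 0 with hind
  set δ : G → ℤ := fun u => if u = 1 then 1 else 0 with hδ
  have hpt : ∀ u, (if u = 1 then (0 : ℤ) else if u ∈ D then 1 else -1) = 2 * ind u - 1 + δ u := by
    intro u
    by_cases hu : u = 1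
    · subst hu; simp [hind, hδ, h1]
    · by_cases huD : u ∈ D <;> simp [hind, hδ, hu, huD]
  have hexp : ∀ u, (2 * ind u - 1 + δ u) * (2 * ind (g * u) - 1 + δ (g * u)) =
      4 * (ind u * ind (g * u)) - 2 * ind u + 2 * (ind u * δ (g * u)) - 2 * ind (g * u) + 1 - δ (g * u)
        + 2 * (δ u * ind (g * u)) - δ u + δ u * δ (g * u) := by intro u; ring
  have S1 : ∑ u, ind u * ind (g * u) = ((univ.filter fun d => d ∈ D ∧ g * d ∈ D).card : ℤ) := by
    rw [hind]; simp only [ite_zero_mul_ite_zero, mul_one]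
    rw [Finset.sum_boole]
  have S2 : ∑ u, ind u = D.card := by
    rw [hind, Finset.sum_boole]; simp
  have S3 : ∑ u, ind (g * u) = D.card := by
    rw [← S2]; exact Fintype.sum_equiv (Equiv.mulLeft g) _ _ fun u => rfl
  have hgu : ∀ u : G, g * u = 1 ↔ u = g⁻¹ := fun u => by
    rw [mul_eq_one_iff_inv_eq, eq_comm]
  have S4 : ∑ u, ind u * δ (g * u) = ind g⁻¹ := by
    rw [hδ]; simp only [hgu, mul_ite, mul_one, mul_zero]; rw [Finset.sum_ite_eq']; simp
  have S5 : ∑ u, δ u * ind (g * u) = ind g := by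
    rw [hδ]; simp only [ite_mul, one_mul, zero_mul]; rw [Finset.sum_ite_eq']; simp
  have S6 : ∑ u, δ u = 1 := by rw [hδ, Finset.sum_ite_eq']; simp
  have S7 : ∑ u, δ (g * u) = 1 := by
    rw [← S6]; exact Fintype.sum_equiv (Equiv.mulLeft g) _ _ fun u => rfl
  have S8 : ∑ u, δ u * δ (g * u) = 0 := by
    rw [hδ]; simp only [ite_mul, one_mul, zero_mul]; rw [Finset.sum_ite_eq']; simp [hg]
  have S9 : ∑ _u : G, (1 : ℤ) = Fintype.card G := by simp
  rw [Finset.sum_congr rfl fun u _ => by rw [hpt u, hpt (g * u), hexp u]]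
  simp only [Finset.sum_add_distrib, Finset.sum_sub_distrib, ← Finset.mul_sum, S1, S2, S3, S4, S5, S6, S7, S8,
    S9]
  rw [hind]
  ring

/-- **No Paley-type partial difference set `(333,166,82,83)` in any group of order `333`** (regular PDS in the sense
of Ma / Seberry–Yamada 2020 §1.9.3: `1 ∉ D = D⁻¹`, and `d₁ d₂⁻¹ (dᵢ ∈ D)` represents each `g ≠ 1` exactly `82` times
if `g ∈ D` and `83` times if `g ∉ D` — counted as `#{d ∈ D : g d ∈ D}`); equivalently no Cayley graph of a group of
order `333` is a conference graph `srg(333,166,82,83)`; equivalently (SY 2020 §8.4) no `C(334)` / `H(668)` arises from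
a group of order `333` this way. -/
theorem no_paleyTypePDS_333 (hG : Fintype.card G = 333) (D : Finset G) (h1 : (1 : G) ∉ D)
    (hinv : ∀ g, g⁻¹ ∈ D ↔ g ∈ D) (hk : D.card = 166)
    (hpds : ∀ g, g ≠ 1 → (univ.filter fun d => d ∈ D ∧ g * d ∈ D).card = if g ∈ D then 82 else 83) :
    False := by
  refine no_groupCore_conference334_left hG (fun u => if u = 1 then (0 : ℤ) else if u ∈ D then 1 else -1)
    (by simp) (fun g hg => by by_cases hgD : g ∈ D <;> simp [hg, hgD]) fun g hg => ?_
  rw [pds_autocorr_left D h1 hg, hpds g hg, hk, hG]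
  simp only [hinv g]
  by_cases hgD : g ∈ D <;> simp [hgD]

/-- **Cayley-graph form.**  No strongly regular graph `srg(333,166,82,83)` — in the adjacency-matrix language of gen 27's
`ConferenceGraph333` (`A` symmetric `0/1`, zero diagonal, row sums `166`, `A² = 83(J + I) − A`) — is a Cayley graph of
a group `G` of order `333` (`A_{xg,xh} = A_{g,h}`): the bordered Seidel matrix of `conference334_of_srg333` would be a
`C(334)` with core developed over `G`. -/
theorem no_cayley_srg333 (hG : Fintype.card G = 333) (A : Matrix G G ℤ) (h01 : ∀ x y, A x y = 0 ∨ A x y = 1)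
    (hsymm : ∀ x y, A y x = A x y) (hdiag : ∀ x, A x x = 0) (hk : ∀ x, ∑ y, A x y = 166)
    (hsrg : ∀ x y, ∑ z, A x z * A z y = 83 * (1 + (if x = y then 1 else 0)) - A x y)
    (hcay : ∀ x g h, A (x * g) (x * h) = A g h) : False := by
  obtain ⟨h1, h2, -, h4, -⟩ := conference334_of_srg333 hG A h01 hsymm hdiag hk hsrg
  refine no_conference334_groupCore hG _ h1 h2 h4 (fun g => rfl)
    (fun u => 1 - (if (1 : G) = u then 1 else 0) - 2 * A 1 u) fun g h => ?_
  have hA : A 1 (g⁻¹ * h) = A g h := by simpa using hcay g⁻¹ g h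
  have hδ : ((1 : G) = g⁻¹ * h) = (g = h) := by
    rw [show ((1 : G) = g⁻¹ * h) = (g⁻¹ * h = 1) from propext eq_comm, inv_mul_eq_one]
  simp only [Matrix.of_apply, Option.elim, hA, hδ]

end forms

end Summit.Ventures.DiscreteObjects.Hadamard
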